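import Literature.Probability.LatticeModels.VillainSpinWaveDuality
import Literature.Probability.LatticeModels.DirichletGreenLimit
import HarnessLib

/-!
# The spin-wave upper bound for the Villain rotator with zero boundary condition:
# `⟨S_0 · S_x⟩ ≤ exp((δ_0 − δ_x, −(1/2β)(−Δ)⁻¹(δ_0 − δ_x)))`, in every cube and in the limit

Proof file for the named fact
`Literature.Probability.LatticeModels.FrohlichSpencerVillainSpinWaveBound` (`VillainSpinWave.lean`;
Fröhlich–Spencer, Comm. Math. Phys. 83 (1982) 411, as printed in Dario–Wu 2020, Prop. 1.1). Of the
four printed clauses — thermodynamic limit, clustering `c₀ + O(|x|^{2−d})`, spin-wave UPPER bound,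
spin-wave LOWER bound with `o(1/β)` correction — this file proves the third, for every `β > 0` and
every limit point of the finite-volume two-point functions (the fact itself, `…_holds`, is NOT
proved here: the lower bound and the clustering are Fröhlich–Spencer's renormalisation-group
analysis of the dual Coulomb gas, FS82 §§3–5, not yet in the tree):

* `dirichletVillainTwoPoint_eq_ratio` — `⟨S_0·S_x⟩_{□,β,0}` is the ratio of cube integrals of the
  duality file with the integer charge `q = δ_0 − δ_x` (`phase_twoPoint`:
  `cos⟨δ_0 − δ_x, θ⟩ = cos(θ̄(0) − θ̄(x))`);
* `greenForm_twoPoint` — `(q, M⁻¹q) = G_{□°}(0,0) + G_{□°}(x,x) − 2G_{□°}(0,x)` with the Dirichlet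
  Green function `dirichletGreen (box d n)` (`M = TᵀT = dirichletMatrix`, `gram_gMat_eq_dirichletMatrix`);
* `abs_dirichletVillainTwoPoint_le_one` — `|⟨S_0·S_x⟩_{□,β,0}| ≤ 1`;
* **`dirichletVillainTwoPoint_le_exp`** — the finite-volume bound
  `⟨S_0·S_x⟩_{□,β,0} ≤ exp(−(G_{□°}(0,0) + G_{□°}(x,x) − 2G_{□°}(0,x))/(2β))` for all `d ≥ 1`,
  `β > 0`, `n`, `x` (`VillainSpinWaveDuality.setIntegral_phase_mul_weight_div_le`);
* `tendsto_dirichletGreen_twoPoint` — the exponents converge to `latticeGreen 0 − latticeGreen x`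
  (`= (δ_0 − δ_x, (−Δ)⁻¹(δ_0 − δ_x))` on `ℤ^d`, `d ≥ 3`; `DirichletGreenLimit.tendsto_dirichletGreen_box`);
* **`le_exp_of_tendsto_dirichletVillainTwoPoint`** — for `d ≥ 3`, `β > 0`: if
  `⟨S_0·S_x⟩_{□_n,β,0} → G` then `G ≤ exp(−(latticeGreen 0 − latticeGreen x)/(2β))`, the printed
  upper bound, in the transcription of `FrohlichSpencerVillainSpinWaveBound`.

Theorems only; no definition and no named fact is introduced.

## References

* [DarioWu2020] P. Dario, W. Wu, arXiv:2002.02946, Ch. 1 §1, Proposition 1.1 (PDF pp. 4–5).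
* [FrohlichSpencerCMP1982] J. Fröhlich, T. Spencer, Comm. Math. Phys. 83 (1982) 411–454, §2
  (duality), §§3–5 (the parts not formalised).
* [Lawler1991] G. F. Lawler, *Intersections of Random Walks* (1991), §1.5 (Dirichlet Green function).
-/

noncomputable section

open MeasureTheory Measure Finset Function Set Matrix Filter
open scoped Topology
open Literature.MathematicalPhysics.QuantumFieldTheory

namespace Literature.Probability.LatticeModels

namespace DirichletVillain

open GaussianCoord

variable {d : ℕ} {n : ℕ} {β : ℝ}

/-! ### Point charges: the observable `cos(θ̄(0) − θ̄(x))` and the Green quadratic form -/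

/-- The real charge is additive: `chargeR (q − q') = chargeR q − chargeR q'`. [folklore] -/
theorem chargeR_sub (q q' : SIdx d n → ℤ) : chargeR (q - q') = chargeR q - chargeR q' := by
  funext a
  simp [chargeR]

/-- Pairing with a point charge evaluates the zero extension: `⟨δ_y, v⟩ = v̄(y)` (`= 0` if `y ∉ □°`).
[folklore] -/
theorem chargeR_indicator_dotProduct (y : Site d) (v : SIdx d n → ℝ) :
    chargeR (fun a : SIdx d n => if (a : Site d) = y then (1 : ℤ) else 0) ⬝ᵥ v = dirichletExtend n v y := by
  simp only [chargeR, dotProduct, Int.cast_ite, Int.cast_one, Int.cast_zero, ite_mul, one_mul, zero_mul]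
  rw [sum_SIdx_ite_eq y v]
  rfl

/-- **The two-point observable is the phase of the charge `δ_0 − δ_x`**:
`cos⟨δ_0 − δ_x, θ⟩ = cos(θ̄(0) − θ̄(x))` (for `x ∉ □°` the charge is `δ_0` and `θ̄(x) = 0`). [folklore] -/
theorem phase_twoPoint (x : Site d) (θ : SIdx d n → ℝ) :
    phase (fun a : SIdx d n => (if (a : Site d) = 0 then (1 : ℤ) else 0) - (if (a : Site d) = x then (1 : ℤ) else 0)) θ =
      Real.cos (dirichletExtend n θ 0 - dirichletExtend n θ x) := by
  rw [phase_eq_cos_dotProduct,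
    show (fun a : SIdx d n => (if (a : Site d) = 0 then (1 : ℤ) else 0) - (if (a : Site d) = x then (1 : ℤ) else 0)) =
      (fun a : SIdx d n => if (a : Site d) = 0 then (1 : ℤ) else 0) -
        (fun a : SIdx d n => if (a : Site d) = x then (1 : ℤ) else 0) from rfl,
    chargeR_sub, sub_dotProduct, chargeR_indicator_dotProduct, chargeR_indicator_dotProduct]

/-- **The two-point function as a ratio of cube integrals with the phase of `δ_0 − δ_x`.** [folklore] -/
theorem dirichletVillainTwoPoint_eq_ratio (β : ℝ) (n : ℕ) (x : Site d) :
    dirichletVillainTwoPoint β n x =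
      (∫ θ in angleCube (SIdx d n),
          phase (fun a : SIdx d n => (if (a : Site d) = 0 then (1 : ℤ) else 0) -
            (if (a : Site d) = x then (1 : ℤ) else 0)) θ * dirichletVillainWeight β n θ) /
        ∫ θ in angleCube (SIdx d n), dirichletVillainWeight β n θ := by
  simp_rw [phase_twoPoint]
  rfl

/-- **The Green bilinear form on point charges is the Dirichlet Green function**:
`⟨δ_y, M⁻¹ δ_z⟩ = G_{□°}(y, z)` for all `y, z ∈ ℤ^d` (`d ≥ 1`; both sides vanish unless
`y, z ∈ □°`), by `gram_gMat_eq_dirichletMatrix`. [cite: Lawler1991, §1.5, p. 29] -/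
theorem chargeR_indicator_dotProduct_inv_gram_mulVec (y z : Site d) :
    chargeR (fun a : SIdx d n => if (a : Site d) = y then (1 : ℤ) else 0) ⬝ᵥ
        ((gram (gMat n))⁻¹ *ᵥ chargeR (fun a : SIdx d n => if (a : Site d) = z then (1 : ℤ) else 0)) =
      dirichletGreen (box d n) y z := by
  rw [chargeR_indicator_dotProduct, gram_gMat_eq_dirichletMatrix]
  have hv : ∀ a : SIdx d n, ((dirichletMatrix (box d n))⁻¹ *ᵥ
      chargeR (fun a : SIdx d n => if (a : Site d) = z then (1 : ℤ) else 0)) a =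
        if hz : z ∈ box d n then (dirichletMatrix (box d n))⁻¹ a ⟨z, hz⟩ else 0 := by
    intro a
    simp only [Matrix.mulVec, dotProduct, chargeR, Int.cast_ite, Int.cast_one, Int.cast_zero, mul_ite,
      mul_one, mul_zero]
    exact sum_SIdx_ite_eq z _
  by_cases hy : y ∈ box d n
  · rw [dirichletExtend_of_mem _ hy, hv]
    by_cases hz : z ∈ box d n
    · rw [dif_pos hz, dirichletGreen_of_mem hy hz]
    · rw [dif_neg hz, dirichletGreen_of_not_mem_right _ _ hz]
  · rw [dirichletExtend_of_not_mem _ hy, dirichletGreen_of_not_mem_left _ hy]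

/-- **The Green quadratic form of `δ_0 − δ_x`**:
`(δ_0 − δ_x, M⁻¹(δ_0 − δ_x)) = G_{□°}(0,0) + G_{□°}(x,x) − 2 G_{□°}(0,x)` — the printed
`(δ_0 − δ_x, (−Δ)⁻¹(δ_0 − δ_x))` in the finite volume `□` with zero boundary condition.
[cite: DarioWu2020, Proposition 1.1 (PDF pp. 4–5)] -/
theorem greenForm_twoPoint (x : Site d) :
    greenForm n (fun a : SIdx d n => (if (a : Site d) = 0 then (1 : ℤ) else 0) -
        (if (a : Site d) = x then (1 : ℤ) else 0)) =
      dirichletGreen (box d n) 0 0 + dirichletGreen (box d n) x x - 2 * dirichletGreen (box d n) 0 x := by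
  rw [greenForm,
    show (fun a : SIdx d n => (if (a : Site d) = 0 then (1 : ℤ) else 0) - (if (a : Site d) = x then (1 : ℤ) else 0)) =
      (fun a : SIdx d n => if (a : Site d) = 0 then (1 : ℤ) else 0) -
        (fun a : SIdx d n => if (a : Site d) = x then (1 : ℤ) else 0) from rfl,
    chargeR_sub, Matrix.mulVec_sub, sub_dotProduct, dotProduct_sub, dotProduct_sub,
    chargeR_indicator_dotProduct_inv_gram_mulVec, chargeR_indicator_dotProduct_inv_gram_mulVec,
    chargeR_indicator_dotProduct_inv_gram_mulVec, chargeR_indicator_dotProduct_inv_gram_mulVec,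
    dirichletGreen_comm (box d n) x 0]
  ring

/-! ### Well-posedness: the weight is continuous, positive, integrable; `|⟨S_0·S_x⟩_□| ≤ 1` -/

/-- The zero-boundary-condition Villain weight is continuous in the interior angles (`β > 0`).
[folklore] -/
theorem continuous_dirichletVillainWeight (hβ : 0 < β) :
    Continuous (dirichletVillainWeight (d := d) β n) := by
  have h : dirichletVillainWeight (d := d) β n = fun θ => ∏ e : EIdx d n, villainKernel β (gradR n θ e) :=
    funext fun θ => dirichletVillainWeight_eq_prod β θ
  rw [h]
  exact continuous_finsetProd _ fun e _ =>
    (continuous_villainKernel hβ).comp ((continuous_apply e).comp continuous_gradR)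

/-- The zero-boundary-condition Villain weight is positive (`β > 0`). [folklore] -/
theorem dirichletVillainWeight_pos (hβ : 0 < β) (θ : SIdx d n → ℝ) : 0 < dirichletVillainWeight β n θ := by
  rw [dirichletVillainWeight_eq_prod]
  exact Finset.prod_pos fun e _ => villainKernel_pos hβ _

/-- The zero-boundary-condition Villain weight is integrable on the angle cube (`β > 0`). [folklore] -/
theorem integrableOn_dirichletVillainWeight (hβ : 0 < β) :
    IntegrableOn (dirichletVillainWeight (d := d) β n) (angleCube (SIdx d n)) := by
  obtain ⟨C, -, hC⟩ := exists_villainKernel_le_const hβ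
  refine Measure.integrableOn_of_bounded (M := C ^ Fintype.card (EIdx d n)) volume_angleCube_lt_top.ne
    (continuous_dirichletVillainWeight hβ).aestronglyMeasurable (Filter.Eventually.of_forall fun θ => ?_)
  rw [Real.norm_eq_abs, abs_of_pos (dirichletVillainWeight_pos hβ θ), dirichletVillainWeight_eq_prod]
  exact prod_villainKernel_le hβ hC _

/-- `|∫ cos⟨q, θ⟩ w_β| ≤ ∫ w_β` on the angle cube (`β > 0`). [folklore] -/
theorem abs_setIntegral_phase_mul_weight_le_setIntegral (hβ : 0 < β) (q : SIdx d n → ℤ) :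
    |∫ θ in angleCube (SIdx d n), phase q θ * dirichletVillainWeight β n θ| ≤
      ∫ θ in angleCube (SIdx d n), dirichletVillainWeight β n θ := by
  rw [← Real.norm_eq_abs]
  refine norm_integral_le_of_norm_le (integrableOn_dirichletVillainWeight hβ)
    (Filter.Eventually.of_forall fun θ => ?_)
  rw [Real.norm_eq_abs, abs_mul, abs_of_pos (dirichletVillainWeight_pos hβ θ)]
  exact mul_le_of_le_one_left (dirichletVillainWeight_pos hβ θ).le (abs_phase_le_one q θ)

end DirichletVillain

open DirichletVillain

variable {d : ℕ}

/-- **`|⟨S_0 · S_x⟩_{□,β,0}| ≤ 1`** for the zero-boundary-condition Villain two-point function on every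
cube (`d ≥ 1`, `β > 0`). [folklore] -/
theorem abs_dirichletVillainTwoPoint_le_one (hd : 0 < d) {β : ℝ} (hβ : 0 < β) (n : ℕ) (x : Site d) :
    |dirichletVillainTwoPoint β n x| ≤ 1 := by
  rw [dirichletVillainTwoPoint_eq_ratio, abs_div, abs_of_pos (setIntegral_weight_pos hd hβ),
    div_le_one (setIntegral_weight_pos hd hβ)]
  exact abs_setIntegral_phase_mul_weight_le_setIntegral hβ _

/-! ### The spin-wave upper bound: finite volume, and in the thermodynamic limit -/

/-- **The finite-volume spin-wave upper bound for the Villain rotator with zero boundary condition**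
(`d ≥ 1`, `β > 0`, every cube `□ = box d (n+1)` and every `x ∈ ℤ^d`):
`⟨S_0 · S_x⟩_{□,β,0} ≤ exp(−(G_{□°}(0,0) + G_{□°}(x,x) − 2G_{□°}(0,x))/(2β))`, `G_{□°} = dirichletGreen (box d n)`
the Green function of `−Δ` with zero boundary condition — i.e. `≤ exp((δ_0 − δ_x, −(1/2β)(−Δ_□)⁻¹(δ_0 − δ_x)))`,
the Gaussian spin-wave value in the volume `□`; exact consequence of the duality transformation
(`VillainSpinWaveDuality.lean`). [cite: DarioWu2020, Proposition 1.1 (PDF pp. 4–5), upper bound] -/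
theorem dirichletVillainTwoPoint_le_exp (hd : 0 < d) {β : ℝ} (hβ : 0 < β) (n : ℕ) (x : Site d) :
    dirichletVillainTwoPoint β n x ≤
      Real.exp (-(dirichletGreen (box d n) 0 0 + dirichletGreen (box d n) x x -
        2 * dirichletGreen (box d n) 0 x) / (2 * β)) := by
  rw [dirichletVillainTwoPoint_eq_ratio, ← greenForm_twoPoint x]
  exact setIntegral_phase_mul_weight_div_le hd hβ _

/-- The finite-volume spin-wave exponents converge to the infinite-volume one (`d ≥ 3`):
`G_{Λ_n}(0,0) + G_{Λ_n}(x,x) − 2G_{Λ_n}(0,x) → latticeGreen 0 − latticeGreen x`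
(`= (δ_0 − δ_x, (−Δ)⁻¹(δ_0 − δ_x))` on `ℤ^d`, `latticeGreen = 2(−Δ)⁻¹`), by `tendsto_dirichletGreen_box`
and the evenness of `latticeGreen`. [folklore] -/
theorem tendsto_dirichletGreen_twoPoint (hd : 3 ≤ d) (x : Site d) :
    Tendsto (fun n : ℕ => dirichletGreen (box d n) 0 0 + dirichletGreen (box d n) x x -
        2 * dirichletGreen (box d n) 0 x) atTop (𝓝 (latticeGreen (0 : Site d) - latticeGreen x)) := by
  have h00 := tendsto_dirichletGreen_box d hd 0 0
  have hxx := tendsto_dirichletGreen_box d hd x x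
  have h0x := tendsto_dirichletGreen_box d hd 0 x
  rw [sub_self] at h00 hxx
  have hneg : latticeGreen (-x) = latticeGreen x := by
    simp only [latticeGreen, Pi.neg_apply, Int.cast_neg, mul_neg, Finset.sum_neg_distrib, Real.cos_neg]
  rw [zero_sub, hneg] at h0x
  have h := (h00.add hxx).sub (h0x.const_mul 2)
  convert h using 2
  ring

/-- **The spin-wave upper bound in the thermodynamic limit** (`d ≥ 3`, `β > 0`): if the
zero-boundary-condition two-point functions `⟨S_0 · S_x⟩_{□_n,β,0}` converge to `G` along the cubes
`□_n = box d (n+1)`, then `G ≤ exp(−(latticeGreen 0 − latticeGreen x)/(2β))` — the upper half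
`⟨S_0 · S_x⟩_{μ^V_β} ≤ exp((δ_0 − δ_x, −(1/2β)Δ⁻¹(δ_0 − δ_x)))` of the printed two-sided bound
(Dario–Wu 2020 Prop. 1.1, after Fröhlich–Spencer 1982), for every `β > 0`, for any limit point.
[cite: DarioWu2020, Proposition 1.1 (PDF pp. 4–5), upper bound] -/
theorem le_exp_of_tendsto_dirichletVillainTwoPoint (hd : 3 ≤ d) {β : ℝ} (hβ : 0 < β) (x : Site d)
    {G : ℝ} (hG : Tendsto (fun n : ℕ => dirichletVillainTwoPoint β n x) atTop (𝓝 G)) :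
    G ≤ Real.exp (-(latticeGreen (0 : Site d) - latticeGreen x) / (2 * β)) := by
  have hlim : Tendsto (fun n : ℕ => Real.exp (-(dirichletGreen (box d n) 0 0 + dirichletGreen (box d n) x x -
      2 * dirichletGreen (box d n) 0 x) / (2 * β))) atTop
      (𝓝 (Real.exp (-(latticeGreen (0 : Site d) - latticeGreen x) / (2 * β)))) :=
    (Real.continuous_exp.tendsto _).comp (((tendsto_dirichletGreen_twoPoint hd x).neg).div_const (2 * β))
  exact le_of_tendsto_of_tendsto' hG hlim fun n => dirichletVillainTwoPoint_le_exp (by omega) hβ n x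

end Literature.Probability.LatticeModels
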